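import Mathlib
import HarnessLib

/-!
# Eisenstein descent: `x² + xy + y² = 9ᵏ ⇒ 3ᵏ ∣ x ∧ 3ᵏ ∣ y` — the «no twist» arithmetic of Σ3ⁿ twin chains

HONEST FRAMING. Venture `Summits/Ventures/Crystal3D` (cell `crystal3d-full`); helper `--supports` the crux `CoaxialWallLaw` (stmt-Ventures-19481)
in its role on lane T's `stub_famOffFamily` / `stub_fLayerBothFaulted` and lane F's T5b core (memos HOME/wall-19481-p1/g17/FAMOFF-SIZING-g17.md (F2),
BOTHFAULTED-LINE-g17.md (R-b), LBR-FEASIBILITY-g17.md §3).  Census-free, Mathlib-only; nothing about the crux is claimed; F-C1 not moved.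

WHY.  A reduced chain of `k` coherent `{111}` twins maps the cubic frame into `3⁻ᵏ`-integral coordinates; if the resulting fcc lattice shares the
threefold AXIS of the original, its in-plane hexagon consists of vectors `(x, y)` (hexagonal coordinates, scaled by `3ᵏ`) with
`x² + xy + y² = 9ᵏ`.  This file proves that such `(x, y)` are `3ᵏ`-multiples of the six units — i.e. the hexagon is UNTWISTED — which is the
number-theoretic half of «a Σ3ⁿ-relative of Λ sharing the axis n is Λ or its basal twin» (the other half is the tree's word rigidity
`word_eq_of_image_eq` / NonReturn `foldl_reflect_slots_false`).  Elementary descent: `x² + xy + y² ≡ (x − y)² (mod 3)`, so `9 ∣ x² + xy + y²`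
forces `3 ∣ x` and `3 ∣ y`.

* `three_dvd_of_nine_dvd_normForm` — `9 ∣ x² + xy + y² → 3 ∣ x ∧ 3 ∣ y`;
* `pow_dvd_of_normForm_eq` — `x² + xy + y² = 9ᵏ → 3ᵏ ∣ x ∧ 3ᵏ ∣ y`;
* `normForm_eq_one_iff` — the six units: `x² + xy + y² = 1 ↔ (x, y) ∈ {(±1,0), (0,±1), (1,−1), (−1,1)}`;
* `normForm_eq_pow_iff` — `x² + xy + y² = 9ᵏ ↔ (x, y) = 3ᵏ • (a unit)`.
-/

namespace Summit.Ventures.Crystal3D.Theorems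

/-- `9 ∣ x² + xy + y²` forces `3 ∣ x` and `3 ∣ y` (since `x² + xy + y² ≡ (x − y)² (mod 3)` and then `3 ∣ 3y² (mod 9)`-bookkeeping). -/
theorem three_dvd_of_nine_dvd_normForm {x y : ℤ} (h : (9 : ℤ) ∣ x ^ 2 + x * y + y ^ 2) : (3 : ℤ) ∣ x ∧ (3 : ℤ) ∣ y := by
  have h3 : (3 : ℤ) ∣ x ^ 2 + x * y + y ^ 2 := dvd_trans (by norm_num) h
  -- x ≡ y (mod 3)
  have hxy : (3 : ℤ) ∣ (x - y) ^ 2 := by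
    have : (x - y) ^ 2 = (x ^ 2 + x * y + y ^ 2) - 3 * (x * y) := by ring
    rw [this]; exact dvd_sub h3 (dvd_mul_right 3 _)
  have hxy' : (3 : ℤ) ∣ x - y := Int.Prime.dvd_pow' (by norm_num) hxy
  obtain ⟨t, ht⟩ := hxy'
  have hx : x = y + 3 * t := by linarith
  -- substitute: x² + xy + y² = 3 (y² + 3yt + 3t²)
  have hy2 : (3 : ℤ) ∣ y ^ 2 := by
    have e : x ^ 2 + x * y + y ^ 2 = 9 * (y * t + t ^ 2) + 3 * y ^ 2 := by rw [hx]; ring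
    rw [e] at h
    obtain ⟨c, hc⟩ := h
    exact ⟨c - (y * t + t ^ 2), by linarith⟩
  have hy : (3 : ℤ) ∣ y := Int.Prime.dvd_pow' (by norm_num) hy2
  refine ⟨?_, hy⟩
  rw [hx]; exact dvd_add hy (dvd_mul_right 3 _)

/-- Descent: `x² + xy + y² = 9ᵏ ⇒ 3ᵏ ∣ x ∧ 3ᵏ ∣ y`. -/
theorem pow_dvd_of_normForm_eq : ∀ (k : ℕ) {x y : ℤ}, x ^ 2 + x * y + y ^ 2 = 9 ^ k → (3 : ℤ) ^ k ∣ x ∧ (3 : ℤ) ^ k ∣ y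
  | 0, x, y, _ => by simp
  | k + 1, x, y, h => by
    have h9 : (9 : ℤ) ∣ x ^ 2 + x * y + y ^ 2 := ⟨9 ^ k, by rw [h]; ring⟩
    obtain ⟨⟨a, rfl⟩, ⟨b, rfl⟩⟩ := three_dvd_of_nine_dvd_normForm h9
    have h' : a ^ 2 + a * b + b ^ 2 = 9 ^ k := by
      have : (9 : ℤ) * (a ^ 2 + a * b + b ^ 2) = 9 * 9 ^ k := by rw [← pow_succ']; rw [← h]; ring
      exact mul_left_cancel₀ (by norm_num) this
    obtain ⟨ha, hb⟩ := pow_dvd_of_normForm_eq k h'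
    exact ⟨by rw [pow_succ']; exact mul_dvd_mul_left 3 ha, by rw [pow_succ']; exact mul_dvd_mul_left 3 hb⟩

/-- The six units of the norm form: `x² + xy + y² = 1` iff `(x, y)` is one of `(1,0), (−1,0), (0,1), (0,−1), (1,−1), (−1,1)`. -/
theorem normForm_eq_one_iff {x y : ℤ} :
    x ^ 2 + x * y + y ^ 2 = 1 ↔
      (x = 1 ∧ y = 0) ∨ (x = -1 ∧ y = 0) ∨ (x = 0 ∧ y = 1) ∨ (x = 0 ∧ y = -1) ∨ (x = 1 ∧ y = -1) ∨ (x = -1 ∧ y = 1) := by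
  constructor
  · intro h
    -- 4(x²+xy+y²) = (2x+y)² + 3y² = 4 ⇒ |y| ≤ 1, |x| ≤ 1
    have hy : y ^ 2 ≤ 1 := by nlinarith [sq_nonneg (2 * x + y)]
    have hx : x ^ 2 ≤ 1 := by nlinarith [sq_nonneg (2 * y + x)]
    have hy' : -1 ≤ y ∧ y ≤ 1 := by constructor <;> nlinarith
    have hx' : -1 ≤ x ∧ x ≤ 1 := by constructor <;> nlinarith
    obtain ⟨hy1, hy2⟩ := hy'
    obtain ⟨hx1, hx2⟩ := hx'
    interval_cases x <;> interval_cases y <;> simp_all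
  · rintro (⟨rfl, rfl⟩ | ⟨rfl, rfl⟩ | ⟨rfl, rfl⟩ | ⟨rfl, rfl⟩ | ⟨rfl, rfl⟩ | ⟨rfl, rfl⟩) <;> norm_num

/-- **No twist**: `x² + xy + y² = 9ᵏ` iff `(x, y) = 3ᵏ·(u, v)` with `(u, v)` one of the six units. -/
theorem normForm_eq_pow_iff {k : ℕ} {x y : ℤ} :
    x ^ 2 + x * y + y ^ 2 = 9 ^ k ↔
      ∃ u v : ℤ, x = 3 ^ k * u ∧ y = 3 ^ k * v ∧
        ((u = 1 ∧ v = 0) ∨ (u = -1 ∧ v = 0) ∨ (u = 0 ∧ v = 1) ∨ (u = 0 ∧ v = -1) ∨ (u = 1 ∧ v = -1) ∨ (u = -1 ∧ v = 1)) := by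
  have h9 : (9 : ℤ) ^ k = (3 ^ k) ^ 2 := by rw [← pow_mul, mul_comm, pow_mul]; norm_num
  constructor
  · intro h
    obtain ⟨⟨u, rfl⟩, ⟨v, rfl⟩⟩ := pow_dvd_of_normForm_eq k h
    refine ⟨u, v, rfl, rfl, normForm_eq_one_iff.1 ?_⟩
    have hne : ((3 : ℤ) ^ k) ^ 2 ≠ 0 := pow_ne_zero _ (pow_ne_zero _ (by norm_num))
    have e : (3 ^ k * u) ^ 2 + 3 ^ k * u * (3 ^ k * v) + (3 ^ k * v) ^ 2 = ((3 : ℤ) ^ k) ^ 2 * (u ^ 2 + u * v + v ^ 2) := by ring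
    have : ((3 : ℤ) ^ k) ^ 2 * (u ^ 2 + u * v + v ^ 2) = ((3 : ℤ) ^ k) ^ 2 * 1 := by rw [← e, h, h9, mul_one]
    exact mul_left_cancel₀ hne this
  · rintro ⟨u, v, rfl, rfl, huv⟩
    have h1 : u ^ 2 + u * v + v ^ 2 = 1 := normForm_eq_one_iff.2 huv
    calc (3 ^ k * u) ^ 2 + 3 ^ k * u * (3 ^ k * v) + (3 ^ k * v) ^ 2 = ((3 : ℤ) ^ k) ^ 2 * (u ^ 2 + u * v + v ^ 2) := by ring
      _ = 9 ^ k := by rw [h1, mul_one, h9]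

end Summit.Ventures.Crystal3D.Theorems
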